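import Summits.HodgeConjecture.CorCM.GaloisOddPrimeShapes
import Summits.HodgeConjecture.CorCM.GaloisCyclicSemidirectTwoPowerAllTypes
import Mathlib.GroupTheory.SemidirectProduct
import HarnessLib

/-!
# SHAPE C(−1) — cyclic Sylow `2`-subgroup acting on `C_p` by inversion — IS THE METACYCLIC MODEL `ℤ/p ⋊ ℤ/2^{a+2}` OF GENS 25–27:
# GOOD for all abelian varieties unless `2^{a+2} ∣ p − 1` or `2^{a+1} ∣ p + 1`

COR-CM (cell `pub-hodgecm2`), binder seat b04 (gen 38), count-neutral own lane «Galois-CM-type classification».  KERNEL ONLY: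
theorems; no definition, no named fact, no `sorry`.  `HC_CM` is neither used nor claimed.

`CorCM/GaloisOddPrimeShapes` leaves the shape C(r): `Gal(K/ℚ) = ⟨u⟩ ⋊ ⟨x⟩`, `u` of odd prime order `p` generating a normal subgroup,
`x` of order `2ⁿ` with `x u x⁻¹ = uʳ`.  For `r = −1` (inversion; `n = a + 2`) this file CONSTRUCTS the model isomorphism
`e : Gal(K/ℚ) ≃* Multiplicative (ZMod p) ⋊[φ] Multiplicative (ZMod (2^{a+2}))` with `φ(1) = ` inversion demanded by the gen-25/26 theorems
(`CorCM/GaloisCyclicSemidirectTwoPowerAllTypes`): `⟨u⟩` and `⟨x⟩` are complementary (coprime orders), Mathlib's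
`SemidirectProduct.mulEquivSubgroup` identifies `Gal(K/ℚ)` with `⟨u⟩ ⋊ ⟨x⟩` for the conjugation action, and `SemidirectProduct.congr'`
transports along `⟨u⟩ ≃* ℤ/p`, `⟨x⟩ ≃* ℤ/2^{a+2}` (any isomorphisms: a generator of `ℤ/2^{a+2}` pulls back to an ODD power of `x`,
which inverts `u`, and inversion commutes with every isomorphism of `⟨u⟩`).  CONSEQUENCE (`hodgeConjectureFor_pow_of_shape_C_inv`):
**in shape C(−1), if `2^{a+2} ∤ p − 1` and `2^{a+1} ∤ p + 1` (e.g. every `p < 2^{a+1} − 1`), the Hodge conjecture holds for every power of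
every abelian variety with CM by `K`** (gen 26's residue-class theorem); residue-field form `…_of_pow_sub_one`.

## References

* [Shimura1998] G. Shimura, *Abelian Varieties with Complex Multiplication and Modular Functions*, §5.1 Prop. 3, §6.2 Thm. 3, §8.2 Prop. 26.
* [Gordon1999HodgeAVSurvey] B. B. Gordon, *A survey of the Hodge conjecture for abelian varieties*, Thm. 6.4, §9.4.3.
* [Kubota1965] T. Kubota, *On the field extension by complex multiplication*, Trans. AMS 118 (1965), §4 Lemma 2.
* [Dodson1984] B. Dodson, *The structure of Galois groups of CM-fields*, Trans. AMS 283 (1984), §5.3.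
* [Rotman1995] J. J. Rotman, *An Introduction to the Theory of Groups*, 4th ed., GTM 148, Thm. 7.20–7.23 (semidirect products).
-/

noncomputable section

open CategoryTheory CategoryTheory.Limits NumberField
open scoped BigOperators

namespace Summit.HodgeConjecture.CorCM.GaloisModels

open Literature.NumberTheory.ComplexMultiplication Literature.AlgebraicGeometry.HodgeTheory
open Literature.AlgebraicGeometry.Motives (AbelianVariety CMType)
open Literature.AlgebraicGeometry.ComplexMultiplication (IsCMTypeRealisation)
open Literature.AlgebraicGeometry.Pohlmann1968 Summit.HodgeConjecture.CorCM.GaloisRank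

/-! ## §1 The model isomorphism -/

section Group

variable {G : Type*} [Group G] [Finite G]

omit [Finite G] in
/-- Odd powers of an inverting element invert: `x u x⁻¹ = u⁻¹`, `j` odd ⟹ `xʲ u x⁻ʲ = u⁻¹`. [folklore] -/
theorem pow_conj_eq_inv_of_odd {u x : G} (hxu : x * u * x⁻¹ = u⁻¹) {j : ℕ} (hj : Odd j) : x ^ j * u * (x ^ j)⁻¹ = u⁻¹ := by
  have hxx : x * x * u * (x * x)⁻¹ = u := by
    calc x * x * u * (x * x)⁻¹ = x * (x * u * x⁻¹) * x⁻¹ := by group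
      _ = x * u⁻¹ * x⁻¹ := by rw [hxu]
      _ = (x * u * x⁻¹)⁻¹ := by group
      _ = u := by rw [hxu, inv_inv]
  obtain ⟨i, rfl⟩ := hj
  have h := pow_mul_eq_of_mul_eq hxx i
  have e1 : x ^ (2 * i + 1) = (x * x) ^ i * x := by rw [pow_succ, pow_mul, pow_two]
  rw [e1]
  calc (x * x) ^ i * x * u * ((x * x) ^ i * x)⁻¹ = (x * x) ^ i * (x * u * x⁻¹) * ((x * x) ^ i)⁻¹ := by group
    _ = (x * x) ^ i * u⁻¹ * ((x * x) ^ i)⁻¹ := by rw [hxu]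
    _ = ((x * x) ^ i * u * ((x * x) ^ i)⁻¹)⁻¹ := by group
    _ = u⁻¹ := by rw [h]

/-- **Shape C(−1) is the metacyclic model `ℤ/p ⋊ ℤ/2^{a+2}`.**  `u` of prime order `p` generating a normal subgroup, `x` of order
`2^{a+2}` with `x u x⁻¹ = u⁻¹`, `|G| = 2^{a+2} p` ⟹ for some `φ` with `φ(1) = ` inversion, `G ≃* Multiplicative (ZMod p) ⋊[φ]
Multiplicative (ZMod (2^{a+2}))`. [cite: Rotman1995, Thm. 7.20–7.23] -/
theorem exists_mulEquiv_semidirect_of_inversion {u x : G} {p a : ℕ} [hp : Fact p.Prime] (hp2 : p ≠ 2) (hou : orderOf u = p)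
    [hP : (Subgroup.zpowers u).Normal] (hox : orderOf x = 2 ^ (a + 2)) (hxu : x * u * x⁻¹ = u⁻¹)
    (hcard : Nat.card G = 2 ^ (a + 2) * p) :
    ∃ φ : Multiplicative (ZMod (2 ^ (a + 2))) →* MulAut (Multiplicative (ZMod p)),
      (∀ v : Multiplicative (ZMod p), φ (Multiplicative.ofAdd 1) v = v⁻¹) ∧
        Nonempty (G ≃* Multiplicative (ZMod p) ⋊[φ] Multiplicative (ZMod (2 ^ (a + 2)))) := by
  classical
  haveI : NeZero (2 ^ (a + 2)) := ⟨by positivity⟩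
  set P : Subgroup G := Subgroup.zpowers u with hPdef
  set S : Subgroup G := Subgroup.zpowers x with hSdef
  have hcardP : Nat.card P = p := by rw [hPdef, Nat.card_zpowers, hou]
  have hcardS : Nat.card S = 2 ^ (a + 2) := by rw [hSdef, Nat.card_zpowers, hox]
  -- `P` and `S` are complementary
  have hPS : P.IsComplement' S := by
    refine Subgroup.isComplement'_of_card_mul_and_disjoint ?_ (Subgroup.disjoint_of_coprime_natCard ?_)
    · rw [hcardP, hcardS, hcard, mul_comm]
    · rw [hcardP, hcardS]
      exact Nat.Coprime.pow_right _ (Nat.coprime_two_left.2 (hp.out.odd_of_ne_two hp2)).symm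
  -- the cyclic models
  have hcardP' : Nat.card (Multiplicative (ZMod p)) = p := by simp
  have hcardS' : Nat.card S = Nat.card (Multiplicative (ZMod (2 ^ (a + 2)))) := by simp [hcardS]
  let fn : P ≃* Multiplicative (ZMod p) := mulEquivOfPrimeCardEq hcardP hcardP'
  haveI : IsCyclic S := by rw [hSdef]; infer_instance
  let fg : S ≃* Multiplicative (ZMod (2 ^ (a + 2))) := mulEquivOfCyclicCardEq hcardS'
  let e₀ := SemidirectProduct.mulEquivSubgroup hPS
  refine ⟨_, ?_, ⟨e₀.symm.trans (SemidirectProduct.congr' fn fg)⟩⟩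
  -- `φ(1) = ` inversion: the generator `fg⁻¹(1)` is an odd power of `x`
  intro v
  set g : S := fg.symm (Multiplicative.ofAdd 1) with hg
  have hog : orderOf (g : G) = 2 ^ (a + 2) := by
    rw [Subgroup.orderOf_coe, hg, MulEquiv.orderOf_eq, orderOf_ofAdd_eq_addOrderOf, ZMod.addOrderOf_one]
  obtain ⟨j, hj⟩ := (Submonoid.mem_powers_iff _ _).1 (mem_powers_iff_mem_zpowers.2 (show (g : G) ∈ Subgroup.zpowers x from g.2))
  have hjodd : Odd j := by
    by_contra heven
    rw [Nat.not_odd_iff_even] at heven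
    obtain ⟨i, rfl⟩ := heven
    have h1 : (g : G) ^ 2 ^ (a + 1) = 1 := by
      rw [← hj, ← pow_mul, show (i + i) * 2 ^ (a + 1) = 2 ^ (a + 2) * i by ring, pow_mul, ← hox, pow_orderOf_eq_one,
        one_pow]
    have h2 : orderOf (g : G) ∣ 2 ^ (a + 1) := orderOf_dvd_of_pow_eq_one h1
    rw [hog] at h2
    have := Nat.le_of_dvd (pow_pos two_pos _) h2
    have : 2 ^ (a + 1) < 2 ^ (a + 2) := Nat.pow_lt_pow_right (by norm_num) (by omega)
    omega
  have hgu : ∀ n : P, (g : G) * n * (g : G)⁻¹ = (n : G)⁻¹ := fun n => by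
    obtain ⟨m, hm⟩ := (Submonoid.mem_powers_iff _ _).1 (mem_powers_iff_mem_zpowers.2 (show (n : G) ∈ Subgroup.zpowers u from n.2))
    rw [← hm, ← conj_pow, ← hj, pow_conj_eq_inv_of_odd hxu hjodd, inv_pow]
  -- compute `φ(1) v`
  have hψ : ∀ (hle : S ≤ Subgroup.normalizer (P : Set G)) (n : P),
      (P.normalizerMonoidHom (Subgroup.inclusion hle g)) n = n⁻¹ := fun hle n => by
    apply Subtype.ext
    rw [Subgroup.normalizerMonoidHom_apply_apply_coe, Subgroup.coe_inclusion, Subgroup.coe_inv]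
    exact hgu n
  simp only [MonoidHom.comp_apply, MonoidHom.coe_coe, MulAut.congr_apply, MulEquiv.trans_apply, ← hg]
  rw [hψ, map_inv, MulEquiv.apply_symm_apply]

end Group

/-! ## §2 Shape C(−1) is GOOD for all abelian varieties under gen 26's residue conditions -/

variable {K : Type} [Field K] [NumberField K] [IsCMField K] [IsGalois ℚ K]
variable {Φ : CMType K} {A : AbelianVariety ℂ} {ι : 𝓞 K →+* End A} {θ : K →+* Module.End ℂ (complexBetti A.X 1)}

/-- **SHAPE C(−1): the Hodge conjecture for every power of every abelian variety with CM by `K`** when `[K:ℚ] = 2^{a+2}·p`,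
`Gal(K/ℚ) = ⟨u⟩ ⋊ ⟨x⟩` with `u` of odd prime order `p` (normal), `x` of order `2^{a+2}` inverting `u`, and `2^{a+2} ∤ p − 1`,
`2^{a+1} ∤ p + 1`. [cite: Shimura1998, §5.1 Prop. 3, §6.2 Thm. 3 and §8.2 Prop. 26] [cite: Gordon1999HodgeAVSurvey, Thm. 6.4 and §9.4.3]
[cite: Kubota1965, §4 Lemma 2] [cite: Dodson1984, §5.3] -/
theorem hodgeConjectureFor_pow_of_shape_C_inv {p a : ℕ} [hp : Fact p.Prime] (hp2 : p ≠ 2)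
    (hdeg : Module.finrank ℚ K = 2 ^ (a + 2) * p) {u x : K ≃ₐ[ℚ] K} (hou : orderOf u = p) [(Subgroup.zpowers u).Normal]
    (hox : orderOf x = 2 ^ (a + 2)) (hxu : x * u * x⁻¹ = u⁻¹) (h1 : ¬ 2 ^ (a + 2) ∣ p - 1) (h2 : ¬ 2 ^ (a + 1) ∣ p + 1)
    (hA : IsCMTypeRealisation Φ A ι θ) (N : ℕ) : HodgeConjectureFor (⨁ fun _ : Fin N => A).dim (⨁ fun _ : Fin N => A).X := by
  obtain ⟨φ, hφ, ⟨e⟩⟩ := exists_mulEquiv_semidirect_of_inversion hp2 hou hox hxu (by rw [IsGalois.card_aut_eq_finrank, hdeg])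
  exact GaloisCyclicSemidirectTwoPower.hodgeConjectureFor_pow_of_not_dvd hp2 h1 h2 φ hφ e hA N

/-- … the same under the residue-field hypotheses `2^{a+1} ∣ p^f − 1`, `2^{a+2} ∤ p^f − 1` (gen 26).
[cite: Shimura1998, §5.1 Prop. 3 and §8.2 Prop. 26] [cite: Gordon1999HodgeAVSurvey, Thm. 6.4] [cite: Kubota1965, §4 Lemma 2] -/
theorem hodgeConjectureFor_pow_of_shape_C_inv_of_pow_sub_one {p a : ℕ} [hp : Fact p.Prime] (hp2 : p ≠ 2)
    (hdeg : Module.finrank ℚ K = 2 ^ (a + 2) * p) {u x : K ≃ₐ[ℚ] K} (hou : orderOf u = p) [(Subgroup.zpowers u).Normal]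
    (hox : orderOf x = 2 ^ (a + 2)) (hxu : x * u * x⁻¹ = u⁻¹) {f : ℕ} (hf1 : 2 ^ (a + 1) ∣ p ^ f - 1)
    (hf2 : ¬ 2 ^ (a + 2) ∣ p ^ f - 1) (hA : IsCMTypeRealisation Φ A ι θ) (N : ℕ) :
    HodgeConjectureFor (⨁ fun _ : Fin N => A).dim (⨁ fun _ : Fin N => A).X := by
  obtain ⟨φ, hφ, ⟨e⟩⟩ := exists_mulEquiv_semidirect_of_inversion hp2 hou hox hxu (by rw [IsGalois.card_aut_eq_finrank, hdeg])
  exact GaloisCyclicSemidirectTwoPower.hodgeConjectureFor_pow_of_pow_sub_one hp2 hf1 hf2 φ hφ e hA N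

/-- … and stable nondegeneracy of every realisation (`2^{a+2} ∤ p − 1`, `2^{a+1} ∤ p + 1`). [cite: Gordon1999HodgeAVSurvey, Thm. 6.4]
[cite: Kubota1965, §4 Lemma 2] -/
theorem isStablyNondegenerate_of_shape_C_inv {p a : ℕ} [hp : Fact p.Prime] (hp2 : p ≠ 2)
    (hdeg : Module.finrank ℚ K = 2 ^ (a + 2) * p) {u x : K ≃ₐ[ℚ] K} (hou : orderOf u = p) [(Subgroup.zpowers u).Normal]
    (hox : orderOf x = 2 ^ (a + 2)) (hxu : x * u * x⁻¹ = u⁻¹) (h1 : ¬ 2 ^ (a + 2) ∣ p - 1) (h2 : ¬ 2 ^ (a + 1) ∣ p + 1)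
    (hA : IsCMTypeRealisation Φ A ι θ) : IsStablyNondegenerate A := by
  obtain ⟨φ, hφ, ⟨e⟩⟩ := exists_mulEquiv_semidirect_of_inversion hp2 hou hox hxu (by rw [IsGalois.card_aut_eq_finrank, hdeg])
  exact GaloisCyclicSemidirectTwoPower.isStablyNondegenerate_of_isCMTypeRealisation_of_not_dvd hp2 h1 h2 φ hφ e hA

end Summit.HodgeConjecture.CorCM.GaloisModels

end
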